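import Summits.HodgeConjecture.HodgeConjecture.Theorems.R90S3PlantedPolynomial   -- ★ P3b (K2E3-p17): `exists_plantedPolynomial`, `map_eq_of_coeff_eq`, `intCast_eq_castHom_of_dvd`
import Mathlib.Data.Nat.ChineseRemainder
import HarnessLib

/-!
# R90-TF · S3 · THEOREMS — `R90S3PlantingTargets` ((U3-F) split, brick B4a): the planted polynomial with FINITELY MANY MONIC TARGETS modulo pairwise-coprime
# moduli, read back EXACTLY — `g mod mᵢ = Tᵢ` — with the constant term pinned and all roots real and negative

R90-TF section S3 (successor dealer R90-C12-plan (g2), deal 2026-09-05T01:12:19Z «B4 → K2E3-p21»; captain K2E3-p17 (g11)'s skeleton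
`R90/S3/SKELETON-P8-AuxGlobaliseField.K2E3-p17-g11.md` §B4; census R90 bus 01:13:34Z: cut B4 = B4a generic (this file) + B4b the specific target list (captain's data));
crux H413 (`stmt-HodgeConjecture-24833`, lane `--supports … --as helper`), route `HCCMUnconditional`.  Serves step B4 «TARGETS mod `Q = p^N · 2^M · ℓ₁ · ℓ₂`» of the
assembly P8 of the (U3-F) socket `stub_R90_S3_auxGlobaliseField` (`Cruxes/H413/Lines/R90_S3_LocalTransportWaveG.lean` :645).  THEOREMS ONLY (no `def`, no `instance`,
no notation, no named fact, no `sorry`); ★∕Mathlib imports only; never imports `Cruxes/…/Lines`.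

THE MATHEMATICS [Neukirch1999 Ch. I §3 (3.6) (Chinese remainder theorem); CasselsFrohlichANT1967 Ch. II §6].  ★ P3b `exists_plantedPolynomial` plants, for a modulus
`Q`, middle residues `r_k ∈ ℤ∕Q` and a positive constant term `c₀`, a monic `g ∈ ℤ[X]` of degree `d` with `g_k ≡ r_k (mod Q)` (`0 < k < d`), `g(0) = c₀` EXACTLY and all
roots real, simple and negative.  Given instead finitely many MONIC TARGETS `Tᵢ ∈ (ℤ∕mᵢ)[X]` of degree `d` modulo pairwise-coprime `mᵢ` with `Tᵢ(0) ≡ c₀`, take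
`Q := ∏ mᵢ` and, coefficient by coefficient, a natural number `n_k ≡ (Tᵢ)_k (mod mᵢ)` for all `i` (Mathlib `Nat.chineseRemainderOfFinset`); planting with `r_k := n_k`
gives `g` with `g mod mᵢ = Tᵢ` for every `i` (★ `map_eq_of_coeff_eq`, `intCast_eq_castHom_of_dvd`), the real-rootedness clauses being those of ★ P3b.  The consumer
(B4b∕P8) instantiates `{mᵢ} = {p^N, 2^M, ℓ₁, ℓ₂}` with `T_{p^N} = H mod p^N`, `T_{2^M} = H₂ mod 2^M`, `T_{ℓⱼ}` from ★ P4′.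
* `exists_nat_forall_natCast_eq` (coefficientwise CRT in `ZMod` form), **`exists_planted_of_targets`**.

HONEST LABEL: HC_CM is proved only modulo the 7 printed citations (2 remaining named inputs: hLiu418 = stmt-HodgeConjecture-24832, h413 =
stmt-HodgeConjecture-24833) until rung 0 closes; sub-brick of the GENUINE residual (U3-F); proves nothing printed; count-neutral.

## References
* [Neukirch1999] J. Neukirch, *Algebraic Number Theory* (1999), Ch. I §3 (3.6).
* [CasselsFrohlichANT1967] J. W. S. Cassels, A. Fröhlich (eds.), *Algebraic Number Theory* (1967), Ch. II §6.
-/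

set_option autoImplicit false
-- the mandated namespace repeats the single-problem summit's segment (`HodgeConjecture.HodgeConjecture`)
set_option linter.dupNamespace false

noncomputable section

namespace Summit.HodgeConjecture.HodgeConjecture.R90.S3

open Polynomial Finset

/-- **Coefficientwise CRT in `ZMod` form**: for pairwise-coprime non-zero moduli `mᵢ` (`i ∈ t`) and residues `aᵢ ∈ ℤ∕mᵢ` there is a natural number `n` with `(n : ℤ∕mᵢ) = aᵢ`
for every `i ∈ t` (Mathlib `Nat.chineseRemainderOfFinset` on the `ZMod.val` lifts). [cite: Neukirch1999, Ch. I §3 (3.6)] -/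
theorem exists_nat_forall_natCast_eq {ι : Type} (t : Finset ι) (m : ι → ℕ) (hm : ∀ i ∈ t, m i ≠ 0)
    (hcop : Set.Pairwise (t : Set ι) (Function.onFun Nat.Coprime m)) (a : ∀ i, ZMod (m i)) :
    ∃ n : ℕ, ∀ i ∈ t, (n : ZMod (m i)) = a i := by
  let sol := Nat.chineseRemainderOfFinset (fun i => (a i).val) m t hm hcop
  refine ⟨sol.1, fun i hi => ?_⟩
  haveI : NeZero (m i) := ⟨hm i hi⟩
  have h : (sol.1 : ZMod (m i)) = (((a i).val : ℕ) : ZMod (m i)) := (ZMod.natCast_eq_natCast_iff _ _ _).2 (sol.2 i hi)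
  rw [h, ZMod.natCast_zmod_val]

/-- **B4a — THE PLANTED POLYNOMIAL WITH PRESCRIBED REDUCTIONS modulo pairwise-coprime moduli.**  For `d ≥ 2`, pairwise-coprime non-zero moduli `mᵢ` (`i ∈ t`), MONIC
targets `Tᵢ ∈ (ℤ∕mᵢ)[X]` of degree `d`, and a positive integer `c₀` with `Tᵢ(0) = c₀ (mod mᵢ)`: there is a MONIC `g ∈ ℤ[X]` of degree `d` with `g(0) = c₀` EXACTLY, `g mod mᵢ = Tᵢ`
for every `i ∈ t`, `d` distinct real roots, every real root negative, and every complex root a negative real (★ P3b `exists_plantedPolynomial` at `Q := ∏ mᵢ` with the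
CRT residues of `exists_nat_forall_natCast_eq`; read back by ★ `map_eq_of_coeff_eq` ∕ `intCast_eq_castHom_of_dvd`). [cite: Neukirch1999, Ch. I §3 (3.6)] [cite: CasselsFrohlichANT1967, Ch. II §6] -/
theorem exists_planted_of_targets {d : ℕ} (hd : 2 ≤ d) {ι : Type} (t : Finset ι) (m : ι → ℕ) (hm : ∀ i ∈ t, m i ≠ 0)
    (hcop : Set.Pairwise (t : Set ι) (Function.onFun Nat.Coprime m)) (T : ∀ i, (ZMod (m i))[X]) (hTm : ∀ i ∈ t, (T i).Monic) (hTd : ∀ i ∈ t, (T i).natDegree = d)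
    (c₀ : ℤ) (hc₀ : 0 < c₀) (hT0 : ∀ i ∈ t, ((c₀ : ℤ) : ZMod (m i)) = (T i).coeff 0) :
    ∃ g : ℤ[X], g.Monic ∧ g.natDegree = d ∧ g.coeff 0 = c₀ ∧ (∀ i ∈ t, g.map (Int.castRingHom (ZMod (m i))) = T i) ∧
      (g.map (Int.castRingHom ℝ)).roots.toFinset.card = d ∧ (∀ x ∈ (g.map (Int.castRingHom ℝ)).roots, x < 0) ∧
        ∀ z : ℂ, (g.map (Int.castRingHom ℂ)).IsRoot z → z.im = 0 ∧ z.re < 0 := by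
  classical
  -- the common modulus `Q = ∏ mᵢ`
  set Q : ℕ := ∏ i ∈ t, m i with hQ
  haveI : NeZero Q := ⟨prod_ne_zero_iff.2 fun i hi => hm i hi⟩
  -- coefficientwise CRT residues
  choose n hn using fun k : ℕ => exists_nat_forall_natCast_eq t m hm hcop fun i => (T i).coeff k
  obtain ⟨g, hgm, hgd, hg0, hmid, hcard, hneg, hcx⟩ := exists_plantedPolynomial hd Q (fun k => (n k : ZMod Q)) c₀ hc₀
  refine ⟨g, hgm, hgd, hg0, fun i hi => ?_, hcard, hneg, hcx⟩
  haveI : NeZero (m i) := ⟨hm i hi⟩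
  have hdvd : m i ∣ Q := dvd_prod_of_mem m hi
  refine map_eq_of_coeff_eq hgm hgd (T i) (hTm i hi) (hTd i hi) (by rw [hg0]; exact hT0 i hi) fun k hk hkd => ?_
  rw [intCast_eq_castHom_of_dvd hdvd (hmid k hk hkd), map_natCast]
  exact hn k i hi

end Summit.HodgeConjecture.HodgeConjecture.R90.S3

end
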